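import Summits.BirchSwinnertonDyer.BirchSwinnertonDyer.Theorems.KimAtThreeShallowEqDeepOfPeriodPosition
import Summits.BirchSwinnertonDyer.BirchSwinnertonDyer.Theses.KimAtThreeKolyvagin
import HarnessLib

/-!
# Crux `KatoKuriharaPortThreeShared` (stmt-BirchSwinnertonDyer-19560) — line `perFactorKato`, skeleton of record v6
# (cell `bsd-addord`, seat kim3 gen 19 = the crux's LEAD; 2026-08-27)

v6 = v5 with the named stub `stub_period` RE-TYPED AS THE ROUTE DECL
**`stub_period : Theses.KimAtThreeKolyvagin.KatoPeriodPositionThree`** — the W2 route's shared SUPPORT ITEM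
**stmt-BirchSwinnertonDyer-21401** (planner g24, route file rev 17, 2026-08-27T19:05Z; FORM A: its body is the single token
`Theorems.KimAtThreeShallowEqDeepPositionDefs.KatoPeriodPositionAtThree`, w2-c4 gen 13 p552920, `@[conjecture] def`; audit
`KimAtThreeShallowEqDeepOfPeriodPositionItem.katoPeriodPositionThree_iff : … ↔ … := Iff.rfl`, w2-c4 gen 14 p563685).  So the line now reads
**«19560 ⟸ stub_S5a ∧ stub_S5bTower ∧ stub_P123 ∧ stub_DR [four Literature cite facts] ∧ ITEM 21401»** — every stub is either a
Literature cite fact or a registered route item; nothing displayed is seat-authored text.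

Content of the item (unchanged from v5): for every 3-adic-tower-surjective globally minimal `W` and every lattice-optimal parametrisation
datum `P` at the conductor, `∃ d ι κK Λ, κK ≠ 0 ∧ KatoPosition W d κK ∧ Kato2004.DefinedExpStarBody W 3 P.f d ι κK Λ` — the MATRIX of the
accepted Literature fact `Kato2004.exists_eulerSystem_definedExpStar_values` (w2-c2 p534555 / w2-c4 p550283; Kato 2004 (8.1.3), 8.12, §9.4 +
§11.3, 9.7, 6.6 (1), 13.3 with `exp*` DEFINED) TOGETHER WITH the position clause POS (the 3-adic position of Kato's constant relative to a
duality-normalised generator of the Néron line) — the route's OWN hypothesis, STRONGER than Kato's fact and not derivable from it (w2-acc5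
`KimAtThreeFineKatoPositionNoFreeLunch.not_forall_zetaFamily_pos`); TRUE on paper for Kato's own datum (LEAD memo HOME/kim3/KIM3-POS-g16.md
Thm A / Cor B, `v₃(κ_W) = −v₃(c_P)`, independently re-derived by w2-acc4 g7 (F1)); not kernel-typable today (no modular-curve cohomology /
lattice comparison `φ^*T₃W = deg φ · V_ℤ₃(f)(1)` in the tree).  The other four stubs are CITE FACTS (Literature `def … : Prop`: [BK90] §3
(S5a); Kato LNM 1553 II Thm. 1.4.1 + BK90 at two levels of a tower (S5b-tower); Kato II Prop. 1.2.3 (P123); Fontaine / Kato II Ex. 1.3.5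
(DR)); (S5b) itself is the THEOREM `PAdicHodge.exists_smul_range_expStarCoord_iff_trace_log_of_tower` (kim3 g17 p542762).

Composition of record, kernel-checked BY NAME: **crux ⟸ (S5a) ∧ (S5b-tower) ∧ (P123) ∧ (DR) ∧ KatoPeriodPositionThree**
= w2-c4 g13's `KimAtThreeShallowEqDeepOfPeriodPosition.katoKuriharaPortThreeShared_of_periodPosition_of_cites` applied to `stub_period`
— the kernel unfolds the route item (a plain `def`, FORM A) to the Defs statement; token-for-token the same term as w2-c4 g14's re-key
`KimAtThreeShallowEqDeepOfPeriodPositionItem.katoKuriharaPortThreeShared_of_katoPeriodPositionThree_of_cites stub_period stub_P123 stub_DR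
stub_S5a stub_S5bTower` (p563685; swap the import for `…OfPeriodPositionItem` to spell it that way — this file keeps the smaller import
cone `…OfPeriodPosition` + the route file, ≈ 9 s on the farm) = w2-acc4 `KimAtThreeFineKatoPositionCrux.katoKuriharaPortThreeShared_of_facts_of_katoPos`
(p528556; hT := kim3 p542762) ∘ w2-c4's `katoPosW_of_periodPosition_of_facts` restricted to the Kato stratum.  FIVE stubs, sorries ONLY
in `stub_*`.  Nothing here is booked; BSD / 19560 / 21401 are NOT proved by this file.
-/

noncomputable section

-- the cell's namespace `Summit.BirchSwinnertonDyer.BirchSwinnertonDyer.…` repeats the summit name by design (D-0017)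
set_option linter.dupNamespace false

open Literature.NumberTheory.PAdicHodge
open Summit.BirchSwinnertonDyer.BirchSwinnertonDyer.Theorems
open Summit.BirchSwinnertonDyer.BirchSwinnertonDyer.Theorems.KimAtThreeShallowEqDeepOfPeriodPosition

namespace Summit.BirchSwinnertonDyer.BirchSwinnertonDyer.Cruxes.KatoKuriharaPortThreeShared.PerFactorKato

/-- STUB (cite fact, [BK90] §3 Prop. 3.8 / Ex. 3.11; Literature `def`, w2-c3): (S5a) `exp*` vanishes exactly on the Kummer image. -/
theorem stub_S5a : expStarCoord_eq_zero_iff_kummer := by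
  sorry

/-- STUB (cite fact, Kato II Thm. 1.4.1 + [BK90] §3 at two levels of a tower; Literature `def`, w2-c3 p511026): (S5b-tower)
— also supplies (S5b) by `exists_smul_range_expStarCoord_iff_trace_log_of_tower`. -/
theorem stub_S5bTower : exists_smul_range_expStarCoord_tower_iff_trace_log := by
  sorry

/-- STUB (cite fact, Kato LNM 1553 II Prop. 1.2.3; Literature `def`, w2-c3 p504202): (P123) cup-log injectivity and dual exponentials
for de Rham representations. -/
theorem stub_P123 : cupLogInjective_and_hasDualExp_of_isDeRham := by
  sorry

/-- STUB (cite fact, Kato LNM 1553 II Ex. 1.3.5 / Fontaine; Literature `def`, w2-c3 p504202): (DR) `V_pE` is de Rham. -/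
theorem stub_DR : isDeRham_restrictedRationalTateRep := by
  sorry

/-- STUB = the W2 route's shared SUPPORT ITEM **stmt-BirchSwinnertonDyer-21401** `Theses.KimAtThreeKolyvagin.KatoPeriodPositionThree`
(FORM A; body = `KimAtThreeShallowEqDeepPositionDefs.KatoPeriodPositionAtThree`, `@[conjecture]`): Kato 2004's datum `(d, ι, κK, Λ)` at
`(W, 3, P.f)` — the Literature MATRIX `Kato2004.DefinedExpStarBody` — chosen WITH the position clause `KatoPosition W d κK`, on every
tower row with a lattice-optimal conductor-level `P`.  This stub closes BY NAME the day item 21401 has a `_holds`. -/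
theorem stub_period :
    Summit.BirchSwinnertonDyer.BirchSwinnertonDyer.Theses.KimAtThreeKolyvagin.KatoPeriodPositionThree := by
  sorry

/-- **The assembly of record (kernel-checked BY NAME): crux ⟸ the five stubs** ((S5b) a theorem from `stub_S5bTower`; the route item
feeds w2-acc4's crux twin through w2-c4's bridge restricted to the Kato stratum, keyed on the item by w2-c4 gen 14 p563685). -/
theorem KatoKuriharaPortThreeShared_of :
    Summit.BirchSwinnertonDyer.BirchSwinnertonDyer.Theses.KimAtThreeKolyvagin.KatoKuriharaPortThreeShared :=
  -- the route item unfolds (`def`, FORM A) to `KimAtThreeShallowEqDeepPositionDefs.KatoPeriodPositionAtThree` (audit `katoPeriodPositionThree_iff := Iff.rfl`, p563685)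
  katoKuriharaPortThreeShared_of_periodPosition_of_cites stub_period stub_P123 stub_DR stub_S5a stub_S5bTower

end Summit.BirchSwinnertonDyer.BirchSwinnertonDyer.Cruxes.KatoKuriharaPortThreeShared.PerFactorKato

end
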